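import Literature.Analysis.Complex.LogDerivZeros
import Mathlib.Analysis.Complex.BorelCaratheodory
import Mathlib.Analysis.Complex.HasPrimitives
import Mathlib.Analysis.Complex.Liouville
import Mathlib.Analysis.Complex.AbsMax
import Mathlib.Analysis.Meromorphic.FactorizedRational
import Mathlib.Analysis.Meromorphic.IsolatedZeros
import Mathlib.Analysis.Calculus.LogDeriv
import Mathlib.Analysis.SpecialFunctions.Complex.Log
import HarnessLib

/-!
# The logarithmic derivative near the zeros in a disc (Landau; Titchmarsh §3.9 Lemma α)

Trunk T-CA (Analysis/Complex). Everything in this file is PROVED. The tree's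
`Literature/Analysis/Complex/LogDerivZeros.lean` proves the same lemma for ENTIRE `f` in Titchmarsh's
rigid normalisation (zeros in `|z − c| ≤ R`, estimate on `|z − c| ≤ R/4`, `sup |f|` over
`|z − c| ≤ 2R`); the version here is for `f` holomorphic on a closed disc only, with four free radii
`r < r₁ < R₂ < R`, which is what the application to `ζ` near its pole requires when only bounds
for `ζ` on `σ > 0` are available (discs about `2 + iT` of radius `< 2`, estimate down to
`σ = 1/4`). The elementary product lemmas (`prod_pow_sub_ne_zero`, `deriv_prod_pow_sub_div`) are
taken from that file.

Let `f` be holomorphic on the closed disc `|z − c| ≤ R` with `f(c) ≠ 0` and `|f| ≤ B` there, and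
let `ρ` run through the zeros of `f` (with multiplicity) in the smaller disc `|z − c| ≤ R₂`. Then on
a still smaller disc `|z − c| ≤ r` (`r < r₁ < R₂ < R`),

  `f'/f(z) = ∑_ρ m(ρ)/(z − ρ) + O(M)`,  `M = log(B/|f(c)|) + N log(R/(R − R₂)) + 1`,

where `N = ∑_ρ m(ρ)` is the number of zeros removed and the implied constant is
`2 r₁ / ((R₂ − r₁)(r₁ − r))` (`norm_logDeriv_sub_sum_le`). This is Titchmarsh's Lemma α of §3.9
(there with the radii `r/4 < r/2 < r` and Jensen's bound for `N` folded into the constant), the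
tool by which `ζ'/ζ(s) = ∑_{|γ − t| ≤ 1} 1/(s − ρ) + O(log t)` is derived (Titchmarsh Thm. 9.6 (A),
Montgomery–Vaughan Lemma 12.1).

Proof (Titchmarsh loc. cit.): write `f = P · G` with `P(z) = ∏_ρ (z − ρ)^{m(ρ)}` (Mathlib's
`MeromorphicOn.extract_zeros_poles`), so that `G` is holomorphic and zero-free on `|z − c| ≤ R₂`; on
`|z − c| = R` one has `|G(z)/G(c)| ≤ (B/|f(c)|)(R/(R − R₂))^N`, hence inside (maximum modulus); the
primitive `h` of `G'/G` with `h(c) = 0` (Mathlib's `DifferentiableOn.isExactOn_ball`) satisfies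
`G = G(c) e^h`, so `Re h ≤ M`; Borel–Carathéodory (Mathlib's `Complex.borelCaratheodory_zero`) bounds
`h` on `|z − c| ≤ r₁`, and Cauchy's estimate bounds `h' = G'/G = f'/f − P'/P` on `|z − c| ≤ r`.

## References

* E. C. Titchmarsh, *The Theory of the Riemann Zeta-Function*, 2nd ed. (rev. D. R. Heath-Brown),
  Oxford 1986, §3.9 Lemma α; Thm. 9.6 (A).
* H. L. Montgomery, R. C. Vaughan, *Multiplicative Number Theory I*, CUP 2007, Lemma 6.3
  (Borel–Carathéodory), Lemma 12.1.
-/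

noncomputable section

open Complex Filter Set Metric MeromorphicOn Real Topology

namespace Literature.Analysis.Complex

variable {f : ℂ → ℂ} {c : ℂ}

/-! ## Dividing out the zeros in a disc -/

/-- On a closed disc on which `f` is holomorphic with `f(c) ≠ 0`, no point has infinite order.
[folklore] -/
theorem meromorphicOrderAt_ne_top_of_analyticOnNhd_closedBall {R : ℝ}
    (hf : AnalyticOnNhd ℂ f (closedBall c R)) (hc : f c ≠ 0) {u : ℂ} (hu : u ∈ closedBall c R) :
    meromorphicOrderAt f u ≠ ⊤ := by
  have hR : 0 ≤ R := by simpa using nonempty_closedBall.1 ⟨u, hu⟩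
  intro htop
  rw [(hf u hu).meromorphicOrderAt_eq] at htop
  have htop' : analyticOrderAt f u = ⊤ := by
    cases h : analyticOrderAt f u with
    | top => rfl
    | coe n => rw [h] at htop; simp at htop
  have h0 := hf.eqOn_zero_of_preconnected_of_eventuallyEq_zero
    (convex_closedBall c R).isPreconnected hu (analyticOrderAt_eq_top.mp htop')
    (mem_closedBall_self hR)
  exact hc h0

/-- **Dividing out the zeros.** If `f` is holomorphic on `|z − c| ≤ R` with `f(c) ≠ 0` and
`0 < R₂ ≤ R`, then `f = P · G` on `|z − c| ≤ R` with `P` the zero-polynomial of the disc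
`|z − c| ≤ R₂` and `G` holomorphic on `|z − c| ≤ R` and zero-free on `|z − c| ≤ R₂` (Titchmarsh §3.9,
proof of Lemma α: "g(s) = f(s) ∏ (s − ρ)⁻¹ is regular … and not zero"). [cite: Titchmarsh1986, §3.9 Lemma α (proof)] -/
theorem exists_eq_prod_pow_sub_mul {R₂ R : ℝ} (hR₂ : 0 < R₂) (hR : R₂ ≤ R)
    (hf : AnalyticOnNhd ℂ f (closedBall c R)) (hc : f c ≠ 0) :
    ∃ G : ℂ → ℂ, AnalyticOnNhd ℂ G (closedBall c R) ∧ (∀ z ∈ closedBall c R₂, G z ≠ 0) ∧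
      ∀ z ∈ closedBall c R, f z =
        (∏ u ∈ ((divisor f (closedBall c R₂)).finiteSupport (isCompact_closedBall c R₂)).toFinset,
          (z - u) ^ (divisor f (closedBall c R₂) u).toNat) * G z := by
  classical
  set U₂ := closedBall c R₂ with hU₂
  have hf₂ : AnalyticOnNhd ℂ f U₂ := hf.mono (closedBall_subset_closedBall hR)
  have hord : ∀ u : U₂, meromorphicOrderAt f u ≠ ⊤ := fun u ↦
    meromorphicOrderAt_ne_top_of_analyticOnNhd_closedBall hf₂ hc u.2
  set D := divisor f U₂ with hD
  have hfin : D.support.Finite := D.finiteSupport (isCompact_closedBall c R₂)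
  obtain ⟨g, hg_an, hg_ne, hfg⟩ := hf₂.meromorphicOn.extract_zeros_poles hord hfin
  set S := hfin.toFinset with hS
  set P : ℂ → ℂ := fun z ↦ ∏ u ∈ S, (z - u) ^ (D u).toNat with hP
  -- `P` is Mathlib's factorized rational function of the (effective) divisor `D`
  have hPeq : ∀ z, P z = (∏ᶠ u, (· - u) ^ (D u)) z := by
    intro z
    rw [Function.FactorizedRational.finprod_eq_fun hfin]
    simp only [hP]
    rw [finprod_eq_prod_of_mulSupport_subset _ (s := S)]
    · refine Finset.prod_congr rfl fun u _ ↦ ?_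
      have h0 : 0 ≤ D u := hf₂.divisor_nonneg u
      conv_rhs => rw [← Int.toNat_of_nonneg h0, zpow_natCast]
    · intro u hu
      rw [Function.mem_mulSupport] at hu
      simp only [hS, Finite.coe_toFinset, Function.mem_support, ne_eq]
      intro h
      exact hu (by rw [h, zpow_zero])
  have hPan : ∀ z, AnalyticAt ℂ P z := fun z ↦ by
    apply Differentiable.analyticAt (f := P)
    simp only [hP]
    fun_prop
  -- off the support of `D`, `P ≠ 0`
  have hPne : ∀ z, D z = 0 → P z ≠ 0 := by
    intro z hz
    refine prod_pow_sub_ne_zero _ fun a ha h ↦ ?_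
    rw [hS, Finite.mem_toFinset, Function.mem_support] at ha
    exact ha (h ▸ hz)
  -- `f = P g` near every point of `U₂`
  have hperf : Preperfect U₂ :=
    (convex_closedBall c R₂).isPreconnected.preperfect_of_nontrivial
      ⟨c, mem_closedBall_self hR₂.le, c + R₂, by simp [hU₂, abs_of_pos hR₂], by
        intro h; have := congrArg Complex.re h; simp at this; exact hR₂.ne' this⟩
  have hPg_an : ∀ x, x ∈ U₂ → AnalyticAt ℂ (fun z ↦ P z * g z) x := fun x hx ↦
    (hPan x).mul (hg_an x hx)
  have hfg' : f =ᶠ[codiscreteWithin U₂] fun z ↦ P z * g z := by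
    filter_upwards [hfg] with z hz
    rw [hz, Pi.smul_apply', smul_eq_mul, hPeq]
  have hloc : ∀ x ∈ U₂, ∀ᶠ z in 𝓝 x, f z = P z * g z := by
    intro x hx
    have h1 := (hf₂ x hx).meromorphicAt.eventuallyEq_nhdsNE_of_eventuallyEq_codiscreteWithin
      (hPg_an x hx).meromorphicAt hx (hperf x hx) hfg'
    exact ((hf₂ x hx).frequently_eq_iff_eventually_eq (hPg_an x hx)).mp h1.frequently
  -- P ≠ 0 off U₂
  have hP0 : ∀ z, z ∉ U₂ → P z ≠ 0 := by
    intro z hz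
    apply hPne
    by_contra h
    exact hz (D.supportWithinDomain (Function.mem_support.2 h))
  -- the function G
  refine ⟨fun z ↦ if z ∈ U₂ then g z else f z / P z, ?_, ?_, ?_⟩
  · intro x hx
    by_cases hxU : x ∈ U₂
    · -- near x, G = g
      refine (hg_an x hxU).congr ?_
      filter_upwards [hloc x hxU] with z hz
      by_cases hzU : z ∈ U₂
      · simp [hzU]
      · simp only [hzU, if_false]
        rw [hz, mul_div_cancel_left₀ _ (hP0 z hzU)]
    · -- near x, G = f / P
      have hopen : U₂ᶜ ∈ 𝓝 x := isClosed_closedBall.isOpen_compl.mem_nhds hxU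
      refine (((hf x hx).div (hPan x)) (hP0 x hxU)).congr ?_
      filter_upwards [hopen] with z hz
      simp only [mem_compl_iff] at hz
      simp [hz]
  · intro z hz
    have hz' : z ∈ U₂ := hz
    beta_reduce
    rw [if_pos hz']
    exact hg_ne ⟨z, hz'⟩
  · intro z hz
    by_cases hzU : z ∈ U₂
    · simp only [hzU, if_true]
      exact (hloc z hzU).self_of_nhds
    · simp only [hzU, if_false]
      rw [mul_div_cancel₀ _ (hP0 z hzU)]


/-! ## The estimate -/

/-- **Titchmarsh §3.9 Lemma α (Landau).** Let `f` be holomorphic on `|z − c| ≤ R` with `f(c) ≠ 0`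
and `|f(z)| ≤ B` there; let `0 < r < r₁ < R₂ < R`, let `ρ` run over the zeros of `f` in
`|z − c| ≤ R₂` with multiplicities `m(ρ)` (Mathlib's `divisor`), `N = ∑ m(ρ)`. Then for
`|z − c| ≤ r` with `f(z) ≠ 0`,
`|f'/f(z) − ∑_ρ m(ρ)/(z − ρ)| ≤ (2 r₁/((R₂ − r₁)(r₁ − r))) · (log(B/|f(c)|) + N log(R/(R − R₂)) + 1)`.
(Titchmarsh: "`f'/f(s) = ∑ 1/(s − ρ) + O(M/r)` for `|s − s₀| ≤ r/4`", with `|f/f(s₀)| < e^M` on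
`|s − s₀| ≤ r` and `ρ` the zeros in `|s − s₀| ≤ r/2`; the count `N` is absorbed there by Jensen.)
[cite: Titchmarsh1986, §3.9 Lemma α] -/
theorem norm_logDeriv_sub_sum_le {r r₁ R₂ R B : ℝ} (hr : 0 < r) (hr₁ : r < r₁) (hR₂ : r₁ < R₂)
    (hR : R₂ < R) (hf : AnalyticOnNhd ℂ f (closedBall c R)) (hc : f c ≠ 0)
    (hB : ∀ z ∈ closedBall c R, ‖f z‖ ≤ B) {z : ℂ} (hz : z ∈ closedBall c r) (hfz : f z ≠ 0) :
    ‖logDeriv f z -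
        ∑ u ∈ ((divisor f (closedBall c R₂)).finiteSupport (isCompact_closedBall c R₂)).toFinset,
          (divisor f (closedBall c R₂) u : ℂ) / (z - u)‖ ≤
      2 * r₁ / ((R₂ - r₁) * (r₁ - r)) *
        (Real.log (B / ‖f c‖) +
          (∑ u ∈ ((divisor f (closedBall c R₂)).finiteSupport (isCompact_closedBall c R₂)).toFinset,
            (divisor f (closedBall c R₂) u : ℝ)) * Real.log (R / (R - R₂)) + 1) := by
  classical
  have hR₂0 : 0 < R₂ := hr.trans (hr₁.trans hR₂)
  have hR0 : 0 < R := hR₂0.trans hR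
  have hRR₂ : 0 < R - R₂ := sub_pos.2 hR
  set U₂ := closedBall c R₂ with hU₂
  set D := divisor f U₂ with hD
  set S := (D.finiteSupport (isCompact_closedBall c R₂)).toFinset with hS
  set n : ℂ → ℕ := fun u ↦ (D u).toNat with hn
  set P : ℂ → ℂ := fun w ↦ ∏ u ∈ S, (w - u) ^ n u with hP
  have hf₂ : AnalyticOnNhd ℂ f U₂ := hf.mono (closedBall_subset_closedBall hR.le)
  obtain ⟨G, hG_an, hG_ne, hfPG⟩ := exists_eq_prod_pow_sub_mul hR₂0 hR.le hf hc
  -- memberships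
  have hzc : ‖z - c‖ ≤ r := by rwa [mem_closedBall, dist_eq_norm] at hz
  have hz₂ : z ∈ ball c R₂ := by
    rw [mem_ball, dist_eq_norm]; linarith
  have hzU₂ : z ∈ U₂ := ball_subset_closedBall hz₂
  have hzR : z ∈ ball c R := by
    rw [mem_ball, dist_eq_norm]; linarith
  have hcU₂ : c ∈ U₂ := mem_closedBall_self hR₂0.le
  have hcR : c ∈ closedBall c R := mem_closedBall_self hR0.le
  have hfc : 0 < ‖f c‖ := norm_pos_iff.2 hc
  have hBc : ‖f c‖ ≤ B := hB c hcR
  have hB0 : 0 < B := hfc.trans_le hBc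
  -- multiplicities
  have hD0 : ∀ u, 0 ≤ D u := fun u ↦ hf₂.divisor_nonneg u
  have hSU : ∀ u ∈ S, u ∈ U₂ := fun u hu ↦
    D.supportWithinDomain ((Finite.mem_toFinset _).1 hu)
  have hSc : ∀ u ∈ S, ‖c - u‖ ≤ R₂ := by
    intro u hu
    have := hSU u hu
    rw [mem_closedBall, dist_eq_norm, norm_sub_rev] at this
    exact this
  set N : ℕ := ∑ u ∈ S, n u with hN
  have hnR : ∀ u, ((n u : ℕ) : ℝ) = (D u : ℝ) := by
    intro u
    simp only [hn]
    conv_rhs => rw [← Int.toNat_of_nonneg (hD0 u)]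
    exact (Int.cast_natCast _).symm
  have hNR : (N : ℝ) = ∑ u ∈ S, (D u : ℝ) := by
    rw [hN]; push_cast; exact Finset.sum_congr rfl fun u _ ↦ hnR u
  have hPdef : ∀ w, P w = ∏ u ∈ S, (w - u) ^ n u := fun w ↦ rfl
  have hPnorm : ∀ w, ‖P w‖ = ∏ u ∈ S, ‖w - u‖ ^ n u := by
    intro w
    rw [hPdef, norm_prod]
    exact Finset.prod_congr rfl fun u _ ↦ norm_pow _ _
  -- D z = 0 (f z ≠ 0), so P z ≠ 0
  have hDz : D z = 0 := by
    rw [hD, hf₂.divisor_apply hzU₂, ((hf₂ z hzU₂).analyticOrderAt_eq_zero).2 hfz]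
    rfl
  have hzS : z ∉ S := by
    rw [hS, Finite.mem_toFinset, Function.mem_support]
    exact fun h ↦ h hDz
  have hzS' : ∀ a ∈ S, z ≠ a := fun a ha h ↦ hzS (h ▸ ha)
  have hPz : P z ≠ 0 := prod_pow_sub_ne_zero _ hzS'
  have hPdiff : Differentiable ℂ P := by simp only [hP]; fun_prop
  -- ‖P c‖ ≤ R₂ ^ N
  have hPc : ‖P c‖ ≤ R₂ ^ N := by
    rw [hPnorm, hN, ← Finset.prod_pow_eq_pow_sum]
    refine Finset.prod_le_prod (fun u _ ↦ by positivity) fun u hu ↦ ?_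
    exact pow_le_pow_left₀ (norm_nonneg _) (hSc u hu) _
  -- ‖P s‖ ≥ (R - R₂) ^ N on the sphere
  have hPs : ∀ s ∈ sphere c R, (R - R₂) ^ N ≤ ‖P s‖ := by
    intro s hs
    rw [mem_sphere, dist_eq_norm] at hs
    rw [hPnorm, hN, ← Finset.prod_pow_eq_pow_sum]
    refine Finset.prod_le_prod (fun u _ ↦ by positivity) fun u hu ↦ ?_
    refine pow_le_pow_left₀ hRR₂.le ?_ _
    have h1 := norm_sub_norm_le (s - c) (u - c)
    rw [show s - c - (u - c) = s - u by ring, hs, norm_sub_rev u c] at h1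
    linarith [hSc u hu]
  -- G on the sphere
  set C₀ : ℝ := B / (R - R₂) ^ N with hC₀
  have hGs : ∀ s ∈ sphere c R, ‖G s‖ ≤ C₀ := by
    intro s hs
    have hsR : s ∈ closedBall c R := sphere_subset_closedBall hs
    have hPs' := hPs s hs
    have hPs0 : 0 < ‖P s‖ := lt_of_lt_of_le (pow_pos hRR₂ N) hPs'
    have h1 : ‖f s‖ = ‖P s‖ * ‖G s‖ := by rw [hfPG s hsR, norm_mul]
    rw [hC₀, le_div_iff₀ (pow_pos hRR₂ N)]
    calc ‖G s‖ * (R - R₂) ^ N ≤ ‖G s‖ * ‖P s‖ :=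
          mul_le_mul_of_nonneg_left hPs' (norm_nonneg _)
      _ = ‖f s‖ := by rw [h1, mul_comm]
      _ ≤ B := hB s hsR
  -- maximum modulus
  have hGd : DifferentiableOn ℂ G (closedBall c R) := hG_an.differentiableOn
  have hGmax : ∀ w ∈ closedBall c R, ‖G w‖ ≤ C₀ := by
    intro w hw
    refine Complex.norm_le_of_forall_mem_frontier_norm_le (U := ball c R) isBounded_ball ?_ ?_ ?_
    · apply DifferentiableOn.diffContOnCl
      rwa [closure_ball c hR0.ne']
    · rwa [frontier_ball c hR0.ne']
    · rwa [closure_ball c hR0.ne']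
  -- ‖G c‖ ≥ ‖f c‖ / R₂ ^ N
  have hGc0 : G c ≠ 0 := hG_ne c hcU₂
  have hGc : ‖f c‖ ≤ R₂ ^ N * ‖G c‖ := by
    rw [hfPG c hcR, norm_mul]
    exact mul_le_mul_of_nonneg_right hPc (norm_nonneg _)
  -- the exponent M
  set M₀ : ℝ := Real.log (B / ‖f c‖) + N * Real.log (R / (R - R₂)) with hM₀
  set M : ℝ := M₀ + 1 with hM
  have hlog1 : 0 ≤ Real.log (B / ‖f c‖) := Real.log_nonneg ((one_le_div hfc).2 hBc)
  have hlog2 : 0 ≤ Real.log (R / (R - R₂)) :=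
    Real.log_nonneg ((one_le_div hRR₂).2 (by linarith))
  have hM₀0 : 0 ≤ M₀ := by positivity
  have hMpos : 0 < M := by linarith
  have hexpM₀ : Real.exp M₀ = B / ‖f c‖ * (R / (R - R₂)) ^ N := by
    rw [hM₀, Real.exp_add, Real.exp_log (div_pos hB0 hfc), ← Real.log_pow,
      Real.exp_log (pow_pos (div_pos hR0 hRR₂) N)]
  have hC₀le : C₀ ≤ Real.exp M₀ * ‖G c‖ := by
    rw [hexpM₀, hC₀]
    have hGc' : ‖f c‖ / R₂ ^ N ≤ ‖G c‖ := by
      rw [div_le_iff₀ (pow_pos hR₂0 N)]; linarith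
    calc B / (R - R₂) ^ N = B / ‖f c‖ * (R / (R - R₂)) ^ N * (‖f c‖ / R ^ N) := by
          field_simp
          rw [← mul_pow, mul_div_cancel₀ _ hRR₂.ne']
        _ ≤ B / ‖f c‖ * (R / (R - R₂)) ^ N * (‖f c‖ / R₂ ^ N) := by
          gcongr
        _ ≤ B / ‖f c‖ * (R / (R - R₂)) ^ N * ‖G c‖ := by
          gcongr
  have hGle : ∀ w ∈ closedBall c R, ‖G w‖ ≤ Real.exp M₀ * ‖G c‖ := fun w hw ↦
    (hGmax w hw).trans hC₀le
  -- the primitive h of G'/G on the ball |w - c| < R₂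
  have hG_ne' : ∀ w ∈ ball c R₂, G w ≠ 0 := fun w hw ↦ hG_ne w (ball_subset_closedBall hw)
  have hGan' : ∀ w ∈ ball c R₂, AnalyticAt ℂ G w := fun w hw ↦
    hG_an w (closedBall_subset_closedBall hR.le (ball_subset_closedBall hw))
  have hLd : DifferentiableOn ℂ (logDeriv G) (ball c R₂) := by
    intro w hw
    have h1 : DifferentiableAt ℂ (deriv G) w := (hGan' w hw).deriv.differentiableAt
    have h2 : DifferentiableAt ℂ G w := (hGan' w hw).differentiableAt
    exact ((h1.div h2 (hG_ne' w hw)).differentiableWithinAt).congr (fun _ _ ↦ rfl) rfl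
  obtain ⟨h, hh0, hh⟩ := hLd.isExactOn_ball.with_val_at c 0
  have hhd : DifferentiableOn ℂ h (ball c R₂) := fun w hw ↦
    (hh w hw).differentiableAt.differentiableWithinAt
  -- G = G(c) exp h on the ball
  have hGexp : ∀ w ∈ ball c R₂, G w = G c * Complex.exp (h w) := by
    have hφd : DifferentiableOn ℂ (fun w ↦ G w * Complex.exp (-h w)) (ball c R₂) := by
      intro w hw
      exact (((hGan' w hw).differentiableAt).mul
        ((hh w hw).differentiableAt.neg.cexp)).differentiableWithinAt
    have hφ' : (ball c R₂).EqOn (deriv fun w ↦ G w * Complex.exp (-h w)) 0 := by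
      intro w hw
      have h1 : HasDerivAt G (deriv G w) w := (hGan' w hw).differentiableAt.hasDerivAt
      have h2 : HasDerivAt (fun w ↦ Complex.exp (-h w)) (Complex.exp (-h w) * -(logDeriv G w)) w :=
        (hh w hw).neg.cexp
      rw [(h1.fun_mul h2).deriv, Pi.zero_apply, logDeriv_apply]
      field_simp [hG_ne' w hw]
      ring
    intro w hw
    have := isOpen_ball.is_const_of_deriv_eq_zero (convex_ball c R₂).isPreconnected hφd hφ' hw
      (mem_ball_self hR₂0)
    simp only [hh0, neg_zero, Complex.exp_zero, mul_one] at this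
    rw [← this, mul_assoc, ← Complex.exp_add, neg_add_cancel, Complex.exp_zero, mul_one]
  -- Re h ≤ M₀ on the ball
  have hRe : ∀ w ∈ ball c R₂, (h w).re ≤ M₀ := by
    intro w hw
    have hwR : w ∈ closedBall c R := closedBall_subset_closedBall hR.le (ball_subset_closedBall hw)
    have h1 := hGle w hwR
    rw [hGexp w hw, norm_mul, Complex.norm_exp, mul_comm] at h1
    have h2 : Real.exp (h w).re ≤ Real.exp M₀ :=
      le_of_mul_le_mul_right h1 (norm_pos_iff.2 hGc0)
    exact Real.exp_le_exp.1 h2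
  -- Borel–Carathéodory: |h| ≤ 2 M r₁ / (R₂ - r₁) on |w - c| ≤ r₁
  set H : ℝ := 2 * M * r₁ / (R₂ - r₁) with hH
  have hBC : ∀ v ∈ closedBall c r₁, ‖h v‖ ≤ H := by
    intro v hv
    rw [mem_closedBall, dist_eq_norm] at hv
    set h₀ : ℂ → ℂ := fun w ↦ h (c + w) with hh₀
    have hmem : ∀ w ∈ ball (0 : ℂ) R₂, c + w ∈ ball c R₂ := by
      intro w hw
      rw [mem_ball, dist_eq_norm] at hw ⊢
      simpa using hw
    have hd₀ : DifferentiableOn ℂ h₀ (ball 0 R₂) := by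
      intro w hw
      exact ((hh (c + w) (hmem w hw)).differentiableAt.comp w
        ((differentiableAt_id).const_add c)).differentiableWithinAt
    have hmaps : MapsTo h₀ (ball 0 R₂) {z | z.re ≤ M} := by
      intro w hw
      simp only [mem_setOf_eq, hh₀]
      exact (hRe _ (hmem w hw)).trans (by linarith)
    have hv' : v - c ∈ ball (0 : ℂ) R₂ := by
      rw [mem_ball, dist_zero_right]; linarith
    have hbc := Complex.borelCaratheodory_zero hMpos hd₀ hmaps hR₂0 hv' (by simp [hh₀, hh0])
    simp only [hh₀, add_sub_cancel] at hbc
    refine hbc.trans ?_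
    rw [hH, div_le_div_iff₀ (by linarith) (by linarith)]
    have hM2 : 0 ≤ 2 * M := by linarith
    nlinarith [mul_le_mul_of_nonneg_left hv hM2, norm_nonneg (v - c)]
  -- Cauchy's estimate for h' at z
  have hderiv : ‖deriv h z‖ ≤ H / (r₁ - r) := by
    have hδ : 0 < r₁ - r := sub_pos.2 hr₁
    have hsub : closedBall z (r₁ - r) ⊆ closedBall c r₁ := by
      intro w hw
      rw [mem_closedBall, dist_eq_norm] at hw ⊢
      have := norm_add_le (w - z) (z - c)
      rw [show w - z + (z - c) = w - c by ring] at this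
      linarith
    have hsub' : closedBall c r₁ ⊆ ball c R₂ := closedBall_subset_ball hR₂
    refine Complex.norm_deriv_le_of_forall_mem_sphere_norm_le hδ ?_ ?_
    · apply DifferentiableOn.diffContOnCl
      rw [closure_ball z hδ.ne']
      exact hhd.mono (hsub.trans hsub')
    · intro w hw
      exact hBC w (hsub (sphere_subset_closedBall hw))
  have hderiv_eq : deriv h z = logDeriv G z := (hh z hz₂).deriv
  -- logDeriv f = logDeriv P + logDeriv G at z
  have hfeq : f =ᶠ[𝓝 z] fun w ↦ P w * G w := by
    filter_upwards [closedBall_mem_nhds_of_mem hzR] with w hw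
    exact hfPG w hw
  have hlogf : logDeriv f z = logDeriv P z + logDeriv G z := by
    have h1 : logDeriv f z = logDeriv (fun w ↦ P w * G w) z := by
      rw [logDeriv_apply, logDeriv_apply, hfeq.deriv_eq, hfeq.self_of_nhds]
    rw [h1, logDeriv_mul z hPz (hG_ne z hzU₂) (hPdiff z)
      (hGan' z hz₂).differentiableAt]
  have hlogP : logDeriv P z = ∑ u ∈ S, (D u : ℂ) / (z - u) := by
    rw [logDeriv_apply, hP, deriv_prod_pow_sub_div n hzS']
    refine Finset.sum_congr rfl fun u _ ↦ ?_
    have : ((n u : ℕ) : ℂ) = (D u : ℂ) := by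
      simp only [hn]
      conv_rhs => rw [← Int.toNat_of_nonneg (hD0 u)]
      exact Int.cast_natCast _
    rw [this]
  -- assemble
  rw [hlogf, hlogP, add_sub_cancel_left, ← hderiv_eq, ← hNR]
  refine hderiv.trans (le_of_eq ?_)
  rw [hH, hM, hM₀]
  field_simp

end Literature.Analysis.Complex

end
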